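import Summits.Ventures.CertifiedManyBodySolver.Downfold.BoxesHg1201ULadderP
import Summits.Ventures.CertifiedManyBodySolver.Downfold.BoxesHg1201TpLadderRungs
import Summits.Ventures.CertifiedManyBodySolver.Downfold.PressureAxis
import HarnessLib

/-!
# The §P.12(b) premise of the Hg-1201 pressure hull, TYPED: a parameter path monotone (or antitone) per coordinate between the two computed
# pressures stays inside the coordinatewise hull box, so every hull word holds along the whole computed segment

Venture CertifiedManyBodySolver, cell `pub/hubbard-downfold` (D-0154 (1)(C) COVERAGE (ii) «Hg-1201»; seat `hubbard-cov-hg1201-unc-3`, lane of record = `t'` +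
the object-E pressure hull, lead R-ma); namespace `Summit.Ventures.CertifiedManyBodySolver.Downfold`. START-HERE §7 (ii): «every Hg-1201 ladder carries the
@0 and @10 rungs and STATES THE HULL PREMISE it uses between them». The hull boxes (`boxHg1201E_M19PHull`, unc-1's v1.13 re-issue `boxHg1201E_M19PHullUR`,
the current `boxHg1201E_M19PHullNR` of `BoxesHg1201TpLadderRungs`) carry words valid at BOTH computed pressures by refinement; for a pressure P strictly
between 0 and 10 GPa the cell's reading §P.12(b) (router/INFLATION-RULES.md §P; mod-2's `Downfold/PressureAxis` / `PressureContinuum*`) is that a one-body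
coordinate MONOTONE under compression between the computed points lies in the hull of its two end values. This file makes that premise an explicit
HYPOTHESIS and draws the conclusion for the Hg-1201 one-band object-E hull, nothing more:

* `boxHg1201E_M19PHullUR_mem_of_monotone_path` — for any path `p : ℝ → (OneBandCoord → ℝ)` on a parameter interval `[a, b]` (pressure, volume, any
  monotone reparametrisation) whose five hull coordinates are each monotone OR antitone on `[a, b]`, with `p a` in the v1.13 @0 column box
  `boxHg1201E_M19uR` and `p b` in the v1.13 @10 column box `boxHg1201E_M19P10uR`, EVERY `p P`, `P ∈ [a, b]`, lies in `boxHg1201E_M19PHullUR`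
  (mod-2's `Inflation.mem_Icc_min_max_of_monotoneOn_or_antitoneOn`, coordinate by coordinate); `…_of_monotone_path'` — the same from the boxes of
  record `boxHg1201E_M19` / `boxHg1201E_M19P10` (they refine the re-issues);
* `holdsOn_path_of_holdsOn_PHullUR` — hence a word on the hull box holds at every point of such a path: the exact content of «the hull word holds on
  the whole computed pressure segment UNDER the §P.12(b) premise».
* §2 (append) the same for the CURRENT hull `boxHg1201E_M19PHullNR` of `BoxesHg1201TpLadderRungs`: a core lemma from the end-point ROW memberships
  (`…_of_endRows`, @10 rows `U ∈ [3, 52/5]`, `n ∈ [79/100, 22/25]`), the two @10 end boxes of record after R-mg (e) (the filling re-issue of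
  `boxHg1201E_M19P10` and of unc-1's `boxHg1201E_M19P10uR` = unc-1's `…uRnR`), their `Refines` into the hull, and the hull's kinematic control
  words carried along the path (`stiffness_kinematic_along_path`).

Everything here is PROVED (0 sorry). HONEST FRAMING: the monotonicity of the downfolded coordinates in P is a MODELLING PREMISE (INFLATION-RULES §P, class H;
lit-1's dossier §7.6 locates the printed directions: |t'/t| and t⊥ move one-signedly under compression in every located source) — it is an INPUT here,
never certified by this file; the boxes are SCREENING-GRADE; no word, no phase or dT_c/dP sentence; no summit statement is proved.
-/

namespace Summit.Ventures.CertifiedManyBodySolver.Downfold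

open Set NonemptyInterval

/-- **THE §P.12(b) PREMISE ⇒ INSIDE THE HULL.** A parameter path whose hull coordinates (`U/t`, `t'/t`, `n`, `t_eff`, `t″/t`) are each monotone or antitone
on `[a, b]`, starting in the v1.13 @0 column box `boxHg1201E_M19uR` and ending in the v1.13 @10 column box `boxHg1201E_M19P10uR`, stays in the pressure-hull box
`boxHg1201E_M19PHullUR` for every `P ∈ [a, b]`. [folklore] -/
theorem boxHg1201E_M19PHullUR_mem_of_monotone_path {p : ℝ → OneBandCoord → ℝ} {a b : ℝ}
    (hmono : ∀ c : OneBandCoord, MonotoneOn (fun P => p P c) (Icc a b) ∨ AntitoneOn (fun P => p P c) (Icc a b))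
    (ha : boxHg1201E_M19uR.Mem (p a)) (hb : boxHg1201E_M19P10uR.Mem (p b)) :
    ∀ P ∈ Icc a b, boxHg1201E_M19PHullUR.Mem (p P) := by
  intro P hP
  obtain ⟨aU, atp, an, aT, atpp⟩ := (boxHg1201E_M19uR_mem_iff (p a)).1 ha
  obtain ⟨bU, btp, bn, bT, btpp⟩ := (boxHg1201E_M19P10uR_mem_iff (p b)).1 hb
  have hU := Inflation.mem_Icc_min_max_of_monotoneOn_or_antitoneOn (hmono .UOverT) (show p a .UOverT ∈ Icc (7 / 2 : ℝ) (52 / 5) from aU)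
    (show p b .UOverT ∈ Icc (3 : ℝ) (51 / 5) from bU) hP
  have htp := Inflation.mem_Icc_min_max_of_monotoneOn_or_antitoneOn (hmono .tpOverT)
    (show p a .tpOverT ∈ Icc (-27 / 50 : ℝ) (-43 / 100) from atp) (show p b .tpOverT ∈ Icc (-49 / 100 : ℝ) (-7 / 20) from btp) hP
  have hn := Inflation.mem_Icc_min_max_of_monotoneOn_or_antitoneOn (hmono .filling) (show p a .filling ∈ Icc (4 / 5 : ℝ) (22 / 25) from an)
    (show p b .filling ∈ Icc (4 / 5 : ℝ) (22 / 25) from bn) hP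
  have ht := Inflation.mem_Icc_min_max_of_monotoneOn_or_antitoneOn (hmono .tEV) (show p a .tEV ∈ Icc (1 / 2 : ℝ) (3 / 5) from aT)
    (show p b .tEV ∈ Icc (51 / 100 : ℝ) (17 / 25) from bT) hP
  have htpp := Inflation.mem_Icc_min_max_of_monotoneOn_or_antitoneOn (hmono .tppOverT) (show p a .tppOverT ∈ Icc (0 : ℝ) 0 from ⟨atpp.ge, atpp.le⟩)
    (show p b .tppOverT ∈ Icc (0 : ℝ) 0 from ⟨btpp.ge, btpp.le⟩) hP
  simp only [Set.mem_Icc] at hU htp hn ht htpp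
  refine (boxHg1201E_M19PHullUR_mem_iff (p P)).2 ⟨⟨?_, ?_⟩, ⟨?_, ?_⟩, ⟨?_, ?_⟩, ⟨?_, ?_⟩, ?_⟩
  · exact le_trans (by norm_num) hU.1
  · exact le_trans hU.2 (by norm_num)
  · exact le_trans (by norm_num) htp.1
  · exact le_trans htp.2 (by norm_num)
  · exact le_trans (by norm_num) hn.1
  · exact le_trans hn.2 (by norm_num)
  · exact le_trans (by norm_num) ht.1
  · exact le_trans ht.2 (by norm_num)
  · have h1 := htpp.1; have h2 := htpp.2
    norm_num at h1 h2
    exact le_antisymm h2 h1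

/-- The same from the boxes OF RECORD as end points (`boxHg1201E_M19` @0, `boxHg1201E_M19P10` @10 — they refine the v1.13 re-issues). [folklore] -/
theorem boxHg1201E_M19PHullUR_mem_of_monotone_path' {p : ℝ → OneBandCoord → ℝ} {a b : ℝ}
    (hmono : ∀ c : OneBandCoord, MonotoneOn (fun P => p P c) (Icc a b) ∨ AntitoneOn (fun P => p P c) (Icc a b))
    (ha : boxHg1201E_M19.Mem (p a)) (hb : boxHg1201E_M19P10.Mem (p b)) :
    ∀ P ∈ Icc a b, boxHg1201E_M19PHullUR.Mem (p P) :=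
  boxHg1201E_M19PHullUR_mem_of_monotone_path hmono (boxHg1201E_M19_refines_uR _ ha) (boxHg1201E_M19P10_refines_uR _ hb)

/-- **A hull word holds along the whole path under the premise**: `HoldsOn W boxHg1201E_M19PHullUR` + coordinatewise monotone/antitone path from the @0 column box
to the @10 column box ⇒ `W (p P)` for every `P ∈ [a, b]` — «the hull word holds on the whole computed pressure segment under §P.12(b)», as a theorem whose
premise is explicit. [folklore] -/
theorem holdsOn_path_of_holdsOn_PHullUR {W : (OneBandCoord → ℝ) → Prop} (hW : HoldsOn W boxHg1201E_M19PHullUR)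
    {p : ℝ → OneBandCoord → ℝ} {a b : ℝ}
    (hmono : ∀ c : OneBandCoord, MonotoneOn (fun P => p P c) (Icc a b) ∨ AntitoneOn (fun P => p P c) (Icc a b))
    (ha : boxHg1201E_M19uR.Mem (p a)) (hb : boxHg1201E_M19P10uR.Mem (p b)) : ∀ P ∈ Icc a b, W (p P) :=
  fun P hP => hW _ (boxHg1201E_M19PHullUR_mem_of_monotone_path hmono ha hb P hP)

/-- **Only the five hull coordinates need the premise**: coordinates the hull leaves UNDETERMINED (`tperp/t`, `V/t`, `W_eV`, `dsd`, `J_meV`) are unconstrained,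
so the monotonicity hypothesis may be taken trivially there — a path that is constant off the five hull coordinates satisfies `hmono` at those coordinates
(`monotoneOn_const`). [folklore] -/
theorem monotone_or_antitone_of_const_coord {p : ℝ → OneBandCoord → ℝ} {a b : ℝ} {c : OneBandCoord} (hc : ∀ P, p P c = p a c) :
    MonotoneOn (fun P => p P c) (Icc a b) ∨ AntitoneOn (fun P => p P c) (Icc a b) := by
  left
  intro x _ y _ _
  simp only [hc x, hc y, le_refl]

/-! ## §2 (append 2026-08-28, same seat) The same for the CURRENT hull `boxHg1201E_M19PHullNR` (R-mg (e): `n @10 ∈ [79/100, 22/25]`; `BoxesHg1201TpLadderRungs` p610736) -/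

open Summit.Ventures.CertifiedManyBodySolver.Observables Summit.Ventures.CertifiedManyBodySolver.Certificates

/-- **Core form, from the end-point ROWS**: if the five hull coordinates of the path are each monotone or antitone on `[a, b]`, the @0 end satisfies the v1.13
@0 rows (`U ∈ [7/2, 52/5]`, `t' ∈ [−27/50, −43/100]`, `n ∈ [4/5, 22/25]`, `t ∈ [1/2, 3/5]`, `t″ = 0`) and the @10 end the current @10 rows (`U ∈ [3, 52/5]` — any of
`[3, 17/2]`, `[3, 51/5]` will do —, `t' ∈ [−49/100, −7/20]`, `n ∈ [79/100, 22/25]`, `t ∈ [51/100, 17/25]`, `t″ = 0`), then the path stays in `boxHg1201E_M19PHullNR`.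
[folklore] -/
theorem boxHg1201E_M19PHullNR_mem_of_monotone_path_of_endRows {p : ℝ → OneBandCoord → ℝ} {a b : ℝ}
    (hmono : ∀ c : OneBandCoord, MonotoneOn (fun P => p P c) (Icc a b) ∨ AntitoneOn (fun P => p P c) (Icc a b))
    (aU : p a .UOverT ∈ Icc (7 / 2 : ℝ) (52 / 5)) (atp : p a .tpOverT ∈ Icc (-27 / 50 : ℝ) (-43 / 100)) (an : p a .filling ∈ Icc (4 / 5 : ℝ) (22 / 25))
    (aT : p a .tEV ∈ Icc (1 / 2 : ℝ) (3 / 5)) (atpp : p a .tppOverT = 0)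
    (bU : p b .UOverT ∈ Icc (3 : ℝ) (52 / 5)) (btp : p b .tpOverT ∈ Icc (-49 / 100 : ℝ) (-7 / 20)) (bn : p b .filling ∈ Icc (79 / 100 : ℝ) (22 / 25))
    (bT : p b .tEV ∈ Icc (51 / 100 : ℝ) (17 / 25)) (btpp : p b .tppOverT = 0) :
    ∀ P ∈ Icc a b, boxHg1201E_M19PHullNR.Mem (p P) := by
  intro P hP
  have hU := Inflation.mem_Icc_min_max_of_monotoneOn_or_antitoneOn (hmono .UOverT) aU bU hP
  have htp := Inflation.mem_Icc_min_max_of_monotoneOn_or_antitoneOn (hmono .tpOverT) atp btp hP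
  have hn := Inflation.mem_Icc_min_max_of_monotoneOn_or_antitoneOn (hmono .filling) an bn hP
  have ht := Inflation.mem_Icc_min_max_of_monotoneOn_or_antitoneOn (hmono .tEV) aT bT hP
  have htpp := Inflation.mem_Icc_min_max_of_monotoneOn_or_antitoneOn (hmono .tppOverT) (show p a .tppOverT ∈ Icc (0 : ℝ) 0 from ⟨atpp.ge, atpp.le⟩)
    (show p b .tppOverT ∈ Icc (0 : ℝ) 0 from ⟨btpp.ge, btpp.le⟩) hP
  simp only [Set.mem_Icc] at hU htp hn ht htpp
  refine (boxHg1201E_M19PHullNR_mem_iff (p P)).2 ⟨⟨?_, ?_⟩, ⟨?_, ?_⟩, ⟨?_, ?_⟩, ⟨?_, ?_⟩, ?_⟩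
  · exact le_trans (by norm_num) hU.1
  · exact le_trans hU.2 (by norm_num)
  · exact le_trans (by norm_num) htp.1
  · exact le_trans htp.2 (by norm_num)
  · exact le_trans (by norm_num) hn.1
  · exact le_trans hn.2 (by norm_num)
  · exact le_trans (by norm_num) ht.1
  · exact le_trans ht.2 (by norm_num)
  · have h1 := htpp.1; have h2 := htpp.2
    norm_num at h1 h2
    exact le_antisymm h2 h1

/-- **THE §P.12(b) PREMISE ⇒ INSIDE THE CURRENT HULL**, end boxes of record: the v1.13 @0 column box `boxHg1201E_M19uR` and THE @10 column with BOTH re-issues of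
record — `boxHg1201E_M19P10uR.withEntry filling [79/100, 22/25]` (= unc-1's `boxHg1201E_M19P10uRnR`, `BoxesHg1201ULadderP` §P2: U/t `[3, 51/5]` v1.13, `n` R-mg (e);
`hg1201E_PHull_nR` and unc-2's `hg1201E_nP10R` are the same entry). [folklore] -/
theorem boxHg1201E_M19PHullNR_mem_of_monotone_path {p : ℝ → OneBandCoord → ℝ} {a b : ℝ}
    (hmono : ∀ c : OneBandCoord, MonotoneOn (fun P => p P c) (Icc a b) ∨ AntitoneOn (fun P => p P c) (Icc a b))
    (ha : boxHg1201E_M19uR.Mem (p a)) (hb : (boxHg1201E_M19P10uR.withEntry .filling hg1201E_PHull_nR).Mem (p b)) :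
    ∀ P ∈ Icc a b, boxHg1201E_M19PHullNR.Mem (p P) := by
  obtain ⟨aU, atp, an, aT, atpp⟩ := (boxHg1201E_M19uR_mem_iff (p a)).1 ha
  rw [Box.mem_withEntry_iff] at hb
  obtain ⟨hbn, hbo⟩ := hb
  have bU := (Entry.mem_ofEnds_iff _ _ _ _ _).1 (hbo _ (by decide) _ boxHg1201E_M19P10uR_U)
  have btp := (Entry.mem_ofEnds_iff _ _ _ _ _).1 (hbo _ (by decide) _ boxHg1201E_M19P10uR_tp)
  have bT := (Entry.mem_ofEnds_iff _ _ _ _ _).1 (hbo _ (by decide) _ boxHg1201E_M19P10uR_t)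
  have btpp := (Entry.mem_ofEnds_iff _ _ _ _ _).1 (hbo _ (by decide) _ boxHg1201E_M19P10uR_tpp)
  have bn := (Entry.mem_ofEnds_iff _ _ _ _ _).1 hbn
  push_cast at bU btp bT btpp bn
  exact boxHg1201E_M19PHullNR_mem_of_monotone_path_of_endRows hmono aU atp an aT atpp ⟨bU.1, by linarith [bU.2]⟩ btp bn bT
    (le_antisymm btpp.2 btpp.1)

/-- The same with the @10 end in the filling re-issue of the box of record `boxHg1201E_M19P10.withEntry filling [79/100, 22/25]` (= unc-2's `boxHg1201E_M19P10nR`,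
U/t `[3, 17/2]` v1.6). [folklore] -/
theorem boxHg1201E_M19PHullNR_mem_of_monotone_path' {p : ℝ → OneBandCoord → ℝ} {a b : ℝ}
    (hmono : ∀ c : OneBandCoord, MonotoneOn (fun P => p P c) (Icc a b) ∨ AntitoneOn (fun P => p P c) (Icc a b))
    (ha : boxHg1201E_M19uR.Mem (p a)) (hb : (boxHg1201E_M19P10.withEntry .filling hg1201E_PHull_nR).Mem (p b)) :
    ∀ P ∈ Icc a b, boxHg1201E_M19PHullNR.Mem (p P) := by
  obtain ⟨aU, atp, an, aT, atpp⟩ := (boxHg1201E_M19uR_mem_iff (p a)).1 ha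
  rw [Box.mem_withEntry_iff] at hb
  obtain ⟨hbn, hbo⟩ := hb
  have bU := (Entry.mem_ofEnds_iff _ _ _ _ _).1 (hbo .UOverT (by decide) hg1201E_M19P10_U rfl)
  have btp := (Entry.mem_ofEnds_iff _ _ _ _ _).1 (hbo .tpOverT (by decide) hg1201E_M19P10_tp rfl)
  have bT := (Entry.mem_ofEnds_iff _ _ _ _ _).1 (hbo .tEV (by decide) hg1201E_M19P10_t rfl)
  have btpp := (Entry.mem_ofEnds_iff _ _ _ _ _).1 (hbo .tppOverT (by decide) hg1201E_M19P10_tpp rfl)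
  have bn := (Entry.mem_ofEnds_iff _ _ _ _ _).1 hbn
  push_cast at bU btp bT btpp bn
  exact boxHg1201E_M19PHullNR_mem_of_monotone_path_of_endRows hmono aU atp an aT atpp ⟨bU.1, by linarith [bU.2]⟩ btp bn bT
    (le_antisymm btpp.2 btpp.1)

/-- **The @10 column with both re-issues of record refines the current hull** (unc-1's `boxHg1201E_M19P10uRnR` by definition; the generic lemma
`withEntry_filling_P10_refines_PHullNR` of `BoxesHg1201TpLadderRungs` at `e = [79/100, 22/25]`). [folklore] -/
theorem withEntry_filling_nR_P10uR_refines_PHullNR :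
    (boxHg1201E_M19P10uR.withEntry .filling hg1201E_PHull_nR).Refines boxHg1201E_M19PHullNR ∧
      (boxHg1201E_M19P10.withEntry .filling hg1201E_PHull_nR).Refines boxHg1201E_M19PHullNR :=
  ⟨(withEntry_filling_P10_refines_PHullNR (e := hg1201E_PHull_nR) fun _ hx => hx).2,
    (withEntry_filling_P10_refines_PHullNR (e := hg1201E_PHull_nR) fun _ hx => hx).1⟩

/-- **A word on the current hull holds along the whole path under the premise** (end boxes: v1.13 @0 column, @10 column with both re-issues of record). [folklore] -/
theorem holdsOn_path_of_holdsOn_PHullNR {W : (OneBandCoord → ℝ) → Prop} (hW : HoldsOn W boxHg1201E_M19PHullNR)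
    {p : ℝ → OneBandCoord → ℝ} {a b : ℝ}
    (hmono : ∀ c : OneBandCoord, MonotoneOn (fun P => p P c) (Icc a b) ∨ AntitoneOn (fun P => p P c) (Icc a b))
    (ha : boxHg1201E_M19uR.Mem (p a)) (hb : (boxHg1201E_M19P10uR.withEntry .filling hg1201E_PHull_nR).Mem (p b)) : ∀ P ∈ Icc a b, W (p P) :=
  fun P hP => hW _ (boxHg1201E_M19PHullNR_mem_of_monotone_path hmono ha hb P hP)

/-- **In particular the hull's kinematic CONTROL words ride along the path**: under the premise, `ρ_s ≤ 0.5188344` and (conditionally on the KT dictionary)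
`T_c ≤ 0.4074917` at EVERY parameter between the two computed pressures — the D-0099 «along this range of pressures» reading of the control word, with its
premise explicit. [cite: HazraVermaRanderia2019, eqs. (2)-(6)] -/
theorem stiffness_kinematic_along_path {p : ℝ → OneBandCoord → ℝ} {a b : ℝ}
    (hmono : ∀ c : OneBandCoord, MonotoneOn (fun P => p P c) (Icc a b) ∨ AntitoneOn (fun P => p P c) (Icc a b))
    (ha : boxHg1201E_M19uR.Mem (p a)) (hb : (boxHg1201E_M19P10uR.withEntry .filling hg1201E_PHull_nR).Mem (p b)) :
    ∀ P ∈ Icc a b, ObsStiffnessSeqCeilingAt (p P .tpOverT) (p P .UOverT) (p P .filling) (5188344 / 10000000) ∧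
      ∀ (ρe : ℝ → ℝ) (Tc : ℝ), ThermalKTDictionaryAt (p P .tpOverT) (p P .UOverT) (p P .filling) ρe Tc → Tc ≤ 0.4074917 :=
  fun P hP => ⟨holdsOn_path_of_holdsOn_PHullNR boxHg1201E_M19PHullNR_stiffness_kinematic hmono ha hb P hP,
    holdsOn_path_of_holdsOn_PHullNR boxHg1201E_M19PHullNR_Tc_le_kinematic_KT hmono ha hb P hP⟩

end Summit.Ventures.CertifiedManyBodySolver.Downfold
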